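import Summits.Ventures.CertifiedManyBodySolver.Downfold.EmeryShapeTrueCornerRule
import Summits.Ventures.CertifiedManyBodySolver.Downfold.EmeryFermiScalePointsHg1201P10TrueCorners
import Summits.Ventures.CertifiedManyBodySolver.Downfold.EmeryFermiScalePointsHg1201P10VirtualCorners
import HarnessLib

/-!
# THE ONE-BAND FERMI-SURFACE SHAPE `t′/t` OF THE WHOLE TYPED 3BE BOX `emeryBoxHg1201P10 (EmeryBoxesPressure)` AT ITS TWO TRUE CORNERS (true-corner rule under certified margins, §B.87 (i);
# router/EMERY-SHAPE-CORNERS.tsv «true» rows)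

Venture CertifiedManyBodySolver, cell `pub/hubbard-downfold` (stage S1; INFLATION-RULES-3to1-B §B.87 (i)), seat hubbard-downfold-mod-4 (technique B, g35); namespace
`Summit.Ventures.CertifiedManyBodySolver.Downfold.Emery`. Everything PROVED (0 sorry). WHAT THIS IS NOT: a statement about HgBa₂CuO₄ @10 GPa (box #19 @10) — the typed box is SCREENING-GRADE; `U = 0`
one-body kinematics of the σ model; object E = the EXACT `t–t′` shape of the σ Fermi surface at the row's own Fermi energy.

For EVERY one-body row of `[1.15, 2.5] × [1.39, 1.54] × [0.68, 0.79] × [0.1156, 0.1156]` eV the one-band `t′/t` lies between its values at the TRUE corners `(Δ₁, a₁, b₂, c₂)` and `(Δ₂, a₂, b₁, c₁)`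
(`EmeryShapeTrueCornerRule`; the t_pp / t_pp′ directions by the MARGIN LEVERS of `EmeryMarginLevers`, margins certified by `norm_num` with the constants `M` printed below), read
over their K = 384 brackets (`EmeryFermiScalePointsHg1201P10TrueCorners`).

| filling | **true-corner window (certified)** | margins (t_pp lower/upper; t_pp′ lower/upper) | two-ray (§B.86 (i)) | g19 sub-box device |
|---|---|---|---|---|
| n_H = 1.125 (ν = 7/16) | **[-0.3155, -0.2459]** | M_b 2.774 / 4.3165; M_c 0.0 / 0.0 | see EmeryBoxesHg1201P10ShapeCorners | [-0.3222,-0.2425] (n_H band) |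
| n_H = 1.16 (ν = 21/50) | **[-0.316, -0.2463]** | M_b 2.8248 / 4.3539; M_c 0.0 / 0.0 | see EmeryBoxesHg1201P10ShapeCorners | [-0.3222,-0.2425] (n_H band) |

Sources: three-band model [HybertsenSchluterChristensen1989, Eq. (1)]; [AndersenEtAl1995, §6]; box rows as cited in the typed object's file.
-/

noncomputable section

namespace Summit.Ventures.CertifiedManyBodySolver.Downfold.Emery

open Real Set

/-- **n_H = 1.125 (ν = 7/16): for every row of the box the one-band Fermi-surface `t′/t` (object E) lies in `[-0.3155, -0.2459]` — its values at the two TRUE corners** (margin levers; margins by `norm_num`). [folklore] -/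
theorem hg1201P10Box_fsRatio_true_nH1125 {Δ a b c : ℝ} (hΔ : Δ ∈ Icc ((23 : ℝ) / 20) ((5 : ℝ) / 2)) (ha : a ∈ Icc ((139 : ℝ) / 100) ((77 : ℝ) / 50)) (hb : b ∈ Icc ((17 : ℝ) / 25) ((79 : ℝ) / 100)) (hc : c ∈ Icc ((289 : ℝ) / 2500) ((289 : ℝ) / 2500)) :
    fsRatio Δ a b c (fermiEnergyOf Δ a b c ((7 : ℝ) / 16)) ∈ Icc ((-631 : ℝ) / 2000) ((-2459 : ℝ) / 10000) := by
  have hSL := (fermiEnergyOf_of_pointBracketCheck truePt_Hg1201P10SL_nH1125_br (by norm_num) (by norm_num) (by norm_num) (ν := (7/16 : ℝ)) (by push_cast; exact ⟨le_rfl, le_rfl⟩)).2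
  have hTL := (fermiEnergyOf_of_pointBracketCheck truePt_Hg1201P10TL_nH1125_br (by norm_num) (by norm_num) (by norm_num) (ν := (7/16 : ℝ)) (by push_cast; exact ⟨le_rfl, le_rfl⟩)).2
  have hSU := (fermiEnergyOf_of_pointBracketCheck truePt_Hg1201P10SU_nH1125_br (by norm_num) (by norm_num) (by norm_num) (ν := (7/16 : ℝ)) (by push_cast; exact ⟨le_rfl, le_rfl⟩)).2
  have hQU := (fermiEnergyOf_of_pointBracketCheck truePt_Hg1201P10QU_nH1125_br (by norm_num) (by norm_num) (by norm_num) (ν := (7/16 : ℝ)) (by push_cast; exact ⟨le_rfl, le_rfl⟩)).2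
  have hTH := (fermiEnergyOf_of_pointBracketCheck truePt_Hg1201P10SU_nH1125_br (by norm_num) (by norm_num) (by norm_num) (ν := (7/16 : ℝ)) (by push_cast; exact ⟨le_rfl, le_rfl⟩)).2
  have hAlo := (fermiEnergyOf_of_pointBracketCheck virtPt_Hg1201P10Alo_nH1125_br (by norm_num) (by norm_num) (by norm_num) (ν := (7/16 : ℝ)) (by push_cast; exact ⟨le_rfl, le_rfl⟩)).2
  have hTop := (fermiEnergyOf_of_pointBracketCheck virtPt_Hg1201P10H_nH1125_br (by norm_num) (by norm_num) (by norm_num) (ν := (7/16 : ℝ)) (by push_cast; exact ⟨le_rfl, le_rfl⟩)).2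
  push_cast at hSL hTL hSU hQU hTH hAlo hTop
  norm_num at hSL hTL hSU hQU hTH hAlo hTop
  obtain ⟨hΔl, hΔu⟩ := hΔ
  obtain ⟨hal, hau⟩ := ha
  constructor
  · have hlow := fsRatio_fermiEnergyOf_trueCorner_lower (Δ₁ := ((23 : ℝ) / 20)) (a₁ := ((139 : ℝ) / 100)) (b₁ := ((17 : ℝ) / 25)) (b₂ := ((79 : ℝ) / 100)) (c₁ := ((289 : ℝ) / 2500)) (c₂ := ((289 : ℝ) / 2500))
      (ν := ((7 : ℝ) / 16)) (pL := ((22387 : ℝ) / 10000)) (qL := ((5751 : ℝ) / 2500)) (Mb := ((1387 : ℝ) / 500)) (Mc := (0 : ℝ)) (by norm_num) hΔl (by norm_num) hal (by norm_num) hb (by norm_num) hc (by norm_num) (by norm_num) (by norm_num)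
      (by norm_num) hSL.1 hAlo.2 (by norm_num) (by norm_num [fsD, fsN]) (by norm_num) (by norm_num) (by norm_num [fsD, fsN]) (by norm_num) (by norm_num [dopingDisc]) (by norm_num [fsD, fsN])
    refine le_trans ?_ hlow
    have hw := (fsRatio_mem_Icc_on_window_of_dopingDisc_nonpos (Δ := ((23 : ℝ) / 20)) (a := ((139 : ℝ) / 100)) (b := ((79 : ℝ) / 100)) (c := ((289 : ℝ) / 2500))
      (p := ((11427 : ℝ) / 5000)) (q := ((5751 : ℝ) / 2500)) (by norm_num) (by norm_num) (by norm_num) (by norm_num) (by norm_num) (by norm_num) (by norm_num) (by norm_num [dopingDisc]) hTL).1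
    refine le_trans ?_ hw
    norm_num [fsRatio, fsD, fsN]
  · have hup := fsRatio_fermiEnergyOf_trueCorner_upper (Δ₁ := ((23 : ℝ) / 20)) (Δ₂ := ((5 : ℝ) / 2)) (a₁ := ((139 : ℝ) / 100)) (a₂ := ((77 : ℝ) / 50)) (b₁ := ((17 : ℝ) / 25)) (b₂ := ((79 : ℝ) / 100)) (c₁ := ((289 : ℝ) / 2500)) (c₂ := ((289 : ℝ) / 2500))
      (ν := ((7 : ℝ) / 16)) (pU := ((5033 : ℝ) / 2500)) (qU := ((4119 : ℝ) / 2000)) (qT := ((1612 : ℝ) / 625)) (Mb := ((8633 : ℝ) / 2000)) (Mc := (0 : ℝ)) (by norm_num) ⟨hΔl, hΔu⟩ (by norm_num) ⟨hal, hau⟩ (by norm_num) hb (by norm_num) hc (by norm_num) (by norm_num) (by norm_num)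
      hTop.2 (by norm_num) (by norm_num) hSU.1 hQU.2 (by norm_num) (by norm_num [fsD, fsN]) (by norm_num) (by norm_num) (by norm_num [fsD, fsN]) (by norm_num) (by norm_num) (by norm_num [fsD, fsN])
    refine le_trans hup ?_
    have hw := (fsRatio_mem_Icc_on_window_of_dopingDisc_nonpos (Δ := ((5 : ℝ) / 2)) (a := ((77 : ℝ) / 50)) (b := ((17 : ℝ) / 25)) (c := ((289 : ℝ) / 2500))
      (p := ((5033 : ℝ) / 2500)) (q := ((10141 : ℝ) / 5000)) (by norm_num) (by norm_num) (by norm_num) (by norm_num) (by norm_num) (by norm_num) (by norm_num) (by norm_num [dopingDisc]) hTH).2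
    refine le_trans hw ?_
    norm_num [fsRatio, fsD, fsN]

/-- **n_H = 1.16 (ν = 21/50): for every row of the box the one-band Fermi-surface `t′/t` (object E) lies in `[-0.316, -0.2463]` — its values at the two TRUE corners** (margin levers; margins by `norm_num`). [folklore] -/
theorem hg1201P10Box_fsRatio_true_nH116 {Δ a b c : ℝ} (hΔ : Δ ∈ Icc ((23 : ℝ) / 20) ((5 : ℝ) / 2)) (ha : a ∈ Icc ((139 : ℝ) / 100) ((77 : ℝ) / 50)) (hb : b ∈ Icc ((17 : ℝ) / 25) ((79 : ℝ) / 100)) (hc : c ∈ Icc ((289 : ℝ) / 2500) ((289 : ℝ) / 2500)) :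
    fsRatio Δ a b c (fermiEnergyOf Δ a b c ((21 : ℝ) / 50)) ∈ Icc ((-79 : ℝ) / 250) ((-2463 : ℝ) / 10000) := by
  have hSL := (fermiEnergyOf_of_pointBracketCheck truePt_Hg1201P10SL_nH116_br (by norm_num) (by norm_num) (by norm_num) (ν := (21/50 : ℝ)) (by push_cast; exact ⟨le_rfl, le_rfl⟩)).2
  have hTL := (fermiEnergyOf_of_pointBracketCheck truePt_Hg1201P10TL_nH116_br (by norm_num) (by norm_num) (by norm_num) (ν := (21/50 : ℝ)) (by push_cast; exact ⟨le_rfl, le_rfl⟩)).2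
  have hSU := (fermiEnergyOf_of_pointBracketCheck truePt_Hg1201P10SU_nH116_br (by norm_num) (by norm_num) (by norm_num) (ν := (21/50 : ℝ)) (by push_cast; exact ⟨le_rfl, le_rfl⟩)).2
  have hQU := (fermiEnergyOf_of_pointBracketCheck truePt_Hg1201P10QU_nH116_br (by norm_num) (by norm_num) (by norm_num) (ν := (21/50 : ℝ)) (by push_cast; exact ⟨le_rfl, le_rfl⟩)).2
  have hTH := (fermiEnergyOf_of_pointBracketCheck truePt_Hg1201P10SU_nH116_br (by norm_num) (by norm_num) (by norm_num) (ν := (21/50 : ℝ)) (by push_cast; exact ⟨le_rfl, le_rfl⟩)).2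
  have hAlo := (fermiEnergyOf_of_pointBracketCheck virtPt_Hg1201P10Alo_nH116_br (by norm_num) (by norm_num) (by norm_num) (ν := (21/50 : ℝ)) (by push_cast; exact ⟨le_rfl, le_rfl⟩)).2
  have hTop := (fermiEnergyOf_of_pointBracketCheck virtPt_Hg1201P10H_nH116_br (by norm_num) (by norm_num) (by norm_num) (ν := (21/50 : ℝ)) (by push_cast; exact ⟨le_rfl, le_rfl⟩)).2
  push_cast at hSL hTL hSU hQU hTH hAlo hTop
  norm_num at hSL hTL hSU hQU hTH hAlo hTop
  obtain ⟨hΔl, hΔu⟩ := hΔ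
  obtain ⟨hal, hau⟩ := ha
  constructor
  · have hlow := fsRatio_fermiEnergyOf_trueCorner_lower (Δ₁ := ((23 : ℝ) / 20)) (a₁ := ((139 : ℝ) / 100)) (b₁ := ((17 : ℝ) / 25)) (b₂ := ((79 : ℝ) / 100)) (c₁ := ((289 : ℝ) / 2500)) (c₂ := ((289 : ℝ) / 2500))
      (ν := ((21 : ℝ) / 50)) (pL := ((10967 : ℝ) / 5000)) (qL := ((22497 : ℝ) / 10000)) (Mb := ((3531 : ℝ) / 1250)) (Mc := (0 : ℝ)) (by norm_num) hΔl (by norm_num) hal (by norm_num) hb (by norm_num) hc (by norm_num) (by norm_num) (by norm_num)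
      (by norm_num) hSL.1 hAlo.2 (by norm_num) (by norm_num [fsD, fsN]) (by norm_num) (by norm_num) (by norm_num [fsD, fsN]) (by norm_num) (by norm_num [dopingDisc]) (by norm_num [fsD, fsN])
    refine le_trans ?_ hlow
    have hw := (fsRatio_mem_Icc_on_window_of_dopingDisc_nonpos (Δ := ((23 : ℝ) / 20)) (a := ((139 : ℝ) / 100)) (b := ((79 : ℝ) / 100)) (c := ((289 : ℝ) / 2500))
      (p := ((22347 : ℝ) / 10000)) (q := ((22497 : ℝ) / 10000)) (by norm_num) (by norm_num) (by norm_num) (by norm_num) (by norm_num) (by norm_num) (by norm_num) (by norm_num [dopingDisc]) hTL).1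
    refine le_trans ?_ hw
    norm_num [fsRatio, fsD, fsN]
  · have hup := fsRatio_fermiEnergyOf_trueCorner_upper (Δ₁ := ((23 : ℝ) / 20)) (Δ₂ := ((5 : ℝ) / 2)) (a₁ := ((139 : ℝ) / 100)) (a₂ := ((77 : ℝ) / 50)) (b₁ := ((17 : ℝ) / 25)) (b₂ := ((79 : ℝ) / 100)) (c₁ := ((289 : ℝ) / 2500)) (c₂ := ((289 : ℝ) / 2500))
      (ν := ((21 : ℝ) / 50)) (pU := ((9893 : ℝ) / 5000)) (qU := ((10087 : ℝ) / 5000)) (qT := ((2527 : ℝ) / 1000)) (Mb := ((43539 : ℝ) / 10000)) (Mc := (0 : ℝ)) (by norm_num) ⟨hΔl, hΔu⟩ (by norm_num) ⟨hal, hau⟩ (by norm_num) hb (by norm_num) hc (by norm_num) (by norm_num) (by norm_num)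
      hTop.2 (by norm_num) (by norm_num) hSU.1 hQU.2 (by norm_num) (by norm_num [fsD, fsN]) (by norm_num) (by norm_num) (by norm_num [fsD, fsN]) (by norm_num) (by norm_num) (by norm_num [fsD, fsN])
    refine le_trans hup ?_
    have hw := (fsRatio_mem_Icc_on_window_of_dopingDisc_nonpos (Δ := ((5 : ℝ) / 2)) (a := ((77 : ℝ) / 50)) (b := ((17 : ℝ) / 25)) (c := ((289 : ℝ) / 2500))
      (p := ((9893 : ℝ) / 5000)) (q := ((9943 : ℝ) / 5000)) (by norm_num) (by norm_num) (by norm_num) (by norm_num) (by norm_num) (by norm_num) (by norm_num) (by norm_num [dopingDisc]) hTH).2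
    refine le_trans hw ?_
    norm_num [fsRatio, fsD, fsN]

end Summit.Ventures.CertifiedManyBodySolver.Downfold.Emery
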